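import Literature.Algebra.Homology.LefschetzNumberTensorChain
import Literature.Algebra.Homology.LefschetzNumber
import HarnessLib

/-!
# `Λ(φ ⊗ ψ) = Λ(φ)·Λ(ψ)` — multiplicativity of the Lefschetz number under the tensor product (LEAF 2)

Layer `Literature/Algebra/Homology` (pure linear algebra over Mathlib; proved theorems only, 0 definitions, 0 named facts,
no instances, no notation). For bounded cochain complexes `C`, `D` of finite-dimensional vector spaces over a field `k`
(`Cⁱ = 0` off `Icc a₁ b₁`, `Dʲ = 0` off `Icc a₂ b₂`) and endomorphisms `φ : C ⟶ C`, `ψ : D ⟶ D`: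

* `sum_negOnePow_smul_sum_filter_eq` — the signed Cauchy rearrangement
  `Σₙ (−1)ⁿ • Σ_{i+j=n} f i · g j = (Σᵢ (−1)ⁱ • f i)·(Σⱼ (−1)ʲ • g j)` with values in a commutative ring (row
  `EulerCharacteristicTensor`'s lemma is the `ℤ`-valued case; this is its `R`-valued twin, proved, not restated);
* `isZero_tensorObj_X` — `(C ⊗ D)ⁿ = 0` off `Icc (a₁ + a₂) (b₁ + b₂)`;
* `sum_negOnePow_smul_trace_tensorHom_f` — CHAIN LEVEL: `Σₙ (−1)ⁿ • tr((φ ⊗ ψ)ⁿ) = (Σᵢ (−1)ⁱ • tr φⁱ)·(Σⱼ (−1)ʲ • tr ψʲ)`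
  (LEAF 1's `trace_tensorHom_f` summed with signs);
* **`lefschetzNumber_tensorHom : Λ(φ ⊗ ψ) = Λ(φ)·Λ(ψ)`** for row `LefschetzNumber`'s `lefschetzNumber` — Hopf (row
  `LefschetzNumber`'s `CochainComplex.lefschetzNumber_eq_sum_Icc`) on `C`, `D` and `C ⊗ D` moves all three Lefschetz numbers to
  chain level; NO homology of a tensor product is computed and no Künneth statement is used;
* `lefschetzNumber_tensorHom_id : Λ(φ ⊗ 𝟙_D) = Λ(φ)·χ_H(D)`.

With `φ = 𝟙`, `ψ = 𝟙` this is row `EulerCharacteristicTensor`'s `homologyEulerChar_tensorObj` (`tr 𝟙 = dim`), not restated.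
Library only (cell `pub-hodge-ring2`, count-neutral); proves nothing about any crux, route or conjecture.

## References

* A. Hatcher, *Algebraic Topology* (2002), §2.C (Lefschetz numbers, Thm. 2C.3) and §3.B (products). [HatcherAT2002]
* S. Lang, *Algebra* (2002), Ch. XVI §2 (`tr(f ⊗ g) = tr f · tr g`), Ch. XX §3. [Lang2002]
-/

open CategoryTheory CategoryTheory.Limits CategoryTheory.MonoidalCategory

universe u

namespace Literature.Algebra.Homology.LefschetzTensor

/-! ### The signed Cauchy rearrangement, ring-valued -/

/-- **`Σ_{n ∈ Icc (a₁+a₂) (b₁+b₂)} (−1)ⁿ • Σ_{(i,j) ∈ Icc a₁ b₁ ×ˢ Icc a₂ b₂, i+j=n} f i · g j = (Σᵢ (−1)ⁱ • f i)·(Σⱼ (−1)ʲ • g j)`**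
with values in a commutative ring. [cite: Lang2002, XX §3] -/
theorem sum_negOnePow_smul_sum_filter_eq {R : Type*} [CommRing R] (a₁ b₁ a₂ b₂ : ℤ) (f g : ℤ → R) :
    ∑ n ∈ Finset.Icc (a₁ + a₂) (b₁ + b₂), (n.negOnePow : ℤ) •
        ∑ p ∈ (Finset.Icc a₁ b₁ ×ˢ Finset.Icc a₂ b₂).filter (fun p : ℤ × ℤ => p.1 + p.2 = n), f p.1 * g p.2 =
      (∑ i ∈ Finset.Icc a₁ b₁, (i.negOnePow : ℤ) • f i) * ∑ j ∈ Finset.Icc a₂ b₂, (j.negOnePow : ℤ) • g j := by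
  have hmaps : ∀ p ∈ Finset.Icc a₁ b₁ ×ˢ Finset.Icc a₂ b₂, p.1 + p.2 ∈ Finset.Icc (a₁ + a₂) (b₁ + b₂) := by
    intro p hp
    simp only [Finset.mem_product, Finset.mem_Icc] at hp ⊢
    omega
  calc ∑ n ∈ Finset.Icc (a₁ + a₂) (b₁ + b₂), (n.negOnePow : ℤ) •
        ∑ p ∈ (Finset.Icc a₁ b₁ ×ˢ Finset.Icc a₂ b₂).filter (fun p : ℤ × ℤ => p.1 + p.2 = n), f p.1 * g p.2
      = ∑ n ∈ Finset.Icc (a₁ + a₂) (b₁ + b₂),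
          ∑ p ∈ (Finset.Icc a₁ b₁ ×ˢ Finset.Icc a₂ b₂).filter (fun p : ℤ × ℤ => p.1 + p.2 = n),
            ((p.1 + p.2).negOnePow : ℤ) • (f p.1 * g p.2) := by
        refine Finset.sum_congr rfl fun n _ => ?_
        rw [Finset.smul_sum]
        refine Finset.sum_congr rfl fun p hp => ?_
        rw [(Finset.mem_filter.1 hp).2]
    _ = ∑ p ∈ Finset.Icc a₁ b₁ ×ˢ Finset.Icc a₂ b₂, ((p.1 + p.2).negOnePow : ℤ) • (f p.1 * g p.2) :=
        Finset.sum_fiberwise_of_maps_to hmaps _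
    _ = ∑ i ∈ Finset.Icc a₁ b₁, ∑ j ∈ Finset.Icc a₂ b₂, ((i.negOnePow : ℤ) • f i) * ((j.negOnePow : ℤ) • g j) := by
        rw [Finset.sum_product]
        refine Finset.sum_congr rfl fun i _ => Finset.sum_congr rfl fun j _ => ?_
        rw [Int.negOnePow_add, Units.val_mul, zsmul_eq_mul, zsmul_eq_mul, zsmul_eq_mul, Int.cast_mul]
        ring
    _ = (∑ i ∈ Finset.Icc a₁ b₁, (i.negOnePow : ℤ) • f i) * ∑ j ∈ Finset.Icc a₂ b₂, (j.negOnePow : ℤ) • g j := by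
        rw [Finset.sum_mul_sum]

/-! ### `Λ(φ ⊗ ψ) = Λ(φ)·Λ(ψ)` -/

variable {k : Type u} [Field k] (C D : CochainComplex (ModuleCat.{u} k) ℤ) (a₁ b₁ a₂ b₂ : ℤ)
  (hC : ∀ i, i ∉ Finset.Icc a₁ b₁ → IsZero (C.X i)) (hD : ∀ j, j ∉ Finset.Icc a₂ b₂ → IsZero (D.X j))
  [∀ i, Module.Finite k (C.X i)] [∀ j, Module.Finite k (D.X j)] (φ : C ⟶ C) (ψ : D ⟶ D)

include hC hD in
/-- `(C ⊗ D)ⁿ = 0` off `Icc (a₁ + a₂) (b₁ + b₂)` (row `TensorObjFinrank`: finite-dimensional of dimension `0`).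
[cite: HatcherAT2002, §3.B] -/
theorem isZero_tensorObj_X (n : ℤ) (hn : n ∉ Finset.Icc (a₁ + a₂) (b₁ + b₂)) :
    IsZero ((HomologicalComplex.tensorObj C D).X n) := by
  haveI := TensorObjFinrank.moduleFinite_tensorObj_X C D a₁ b₁ a₂ b₂ hC hD n
  haveI : Subsingleton ((HomologicalComplex.tensorObj C D).X n) :=
    Module.finrank_zero_iff.1 (TensorObjFinrank.finrank_tensorObj_X_eq_zero C D a₁ b₁ a₂ b₂ hC hD n hn)
  exact ModuleCat.isZero_of_subsingleton _

include hC hD in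
/-- **Chain level**: `Σ_{n ∈ Icc (a₁+a₂) (b₁+b₂)} (−1)ⁿ • tr((φ ⊗ ψ)ⁿ) = (Σ_{i ∈ Icc a₁ b₁} (−1)ⁱ • tr φⁱ)·(Σ_{j ∈ Icc a₂ b₂} (−1)ʲ • tr ψʲ)`.
[cite: HatcherAT2002, §2.C and §3.B] [cite: Lang2002, XVI §2] -/
theorem sum_negOnePow_smul_trace_tensorHom_f :
    ∑ n ∈ Finset.Icc (a₁ + a₂) (b₁ + b₂), (n.negOnePow : ℤ) •
        LinearMap.trace k ((HomologicalComplex.tensorObj C D).X n) ((HomologicalComplex.tensorHom φ ψ).f n).hom =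
      (∑ i ∈ Finset.Icc a₁ b₁, (i.negOnePow : ℤ) • LinearMap.trace k (C.X i) (φ.f i).hom) *
        ∑ j ∈ Finset.Icc a₂ b₂, (j.negOnePow : ℤ) • LinearMap.trace k (D.X j) (ψ.f j).hom := by
  rw [Finset.sum_congr rfl fun n _ => by rw [trace_tensorHom_f C D a₁ b₁ a₂ b₂ hC hD φ ψ n]]
  exact sum_negOnePow_smul_sum_filter_eq a₁ b₁ a₂ b₂ (fun i => LinearMap.trace k (C.X i) (φ.f i).hom)
    (fun j => LinearMap.trace k (D.X j) (ψ.f j).hom)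

include hC hD in
/-- **`Λ(φ ⊗ ψ) = Λ(φ)·Λ(ψ)`** — the Lefschetz number of a tensor product of endomorphisms of bounded cochain complexes of
finite-dimensional vector spaces is the product of the Lefschetz numbers (Hopf on the three complexes + the chain-level
product formula; no homology of `C ⊗ D` is computed). [cite: HatcherAT2002, §2.C and §3.B] [cite: Lang2002, XVI §2] -/
theorem lefschetzNumber_tensorHom :
    Lefschetz.lefschetzNumber (HomologicalComplex.tensorHom φ ψ) =
      Lefschetz.lefschetzNumber φ * Lefschetz.lefschetzNumber ψ := by
  haveI := fun n => TensorObjFinrank.moduleFinite_tensorObj_X C D a₁ b₁ a₂ b₂ hC hD n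
  rw [CochainComplex.lefschetzNumber_eq_sum_Icc (HomologicalComplex.tensorObj C D) (HomologicalComplex.tensorHom φ ψ)
      (a₁ + a₂) (b₁ + b₂) (isZero_tensorObj_X C D a₁ b₁ a₂ b₂ hC hD),
    CochainComplex.lefschetzNumber_eq_sum_Icc C φ a₁ b₁ hC, CochainComplex.lefschetzNumber_eq_sum_Icc D ψ a₂ b₂ hD]
  exact sum_negOnePow_smul_trace_tensorHom_f C D a₁ b₁ a₂ b₂ hC hD φ ψ

include hC hD in
/-- **`Λ(φ ⊗ 𝟙_D) = Λ(φ)·χ_H(D)`** (the Lefschetz number of `φ × id`: `Λ(𝟙_D) = χ_H(D)` by row `LefschetzNumber`, with the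
finite-dimensionality / finite support of `H(D)` from rows `HopfTraceFormula` / `EulerPoincareFormula`).
[cite: HatcherAT2002, §2.C and §3.B] -/
theorem lefschetzNumber_tensorHom_id :
    Lefschetz.lefschetzNumber (HomologicalComplex.tensorHom φ (𝟙 D)) =
      Lefschetz.lefschetzNumber φ * (D.homologyEulerChar : k) := by
  haveI := fun j => HopfTrace.moduleFinite_homology D j
  have hD' : (GradedObject.finrankSupport D.X).Finite := by
    refine (Finset.Icc a₂ b₂).finite_toSet.subset fun j hj => ?_
    by_contra hj'
    haveI := ModuleCat.subsingleton_of_isZero (hD j hj')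
    exact hj Module.finrank_zero_of_subsingleton
  rw [lefschetzNumber_tensorHom C D a₁ b₁ a₂ b₂ hC hD φ (𝟙 D),
    Lefschetz.lefschetzNumber_id D (hD'.subset (EulerPoincare.finrankSupport_homology_subset D))]

end Literature.Algebra.Homology.LefschetzTensor
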